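import Summits.NavierStokesRegularity.NavierStokesRegularity.Theses.PlaneEnergyCeiling
import HarnessLib.Audit

/-!
# Birth skeleton (BC3) of the crux `PlaneEnergyCeiling.BoundedPlanarEnergyRegularity`

(crux item `stmt-NavierStokesRegularity-16921`, rank 3 (co-ranked), route
`route-NavierStokesRegularity-PlaneEnergyCeiling` — the SECOND HYPOTHESIS of that route's deciding theorem
`closes (h₁ : PlanarEnergyAPriori) (h₂ : BoundedPlanarEnergyRegularity) : NavierStokesRegularity`;
tree path `Cruxes/BoundedPlanarEnergyRegularity/Lines/birth.lean`; registrar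
`planner-skel-stmt-NavierStokesRegularity-16921-0`, 2026-08-17. The route (rev 13) predates the Lean
birth certificate for this crux; this file supplies BC3 retroactively. `ledger crux ls` showed no
workfiles for the crux at registration: there is no `Disproof.lean`, hence no `_false_without_`
obstruction to honour and no landed `Negative/` lemma to check the stubs against. Negatives index of
the summit (4 entries: FiniteTangentModuli 4055, PerpetualPump 1832, CorrectorSolvable 1429,
BlowupClayNonuniqueness 0154) untouched — the only nearby witness type, the parasitic drifts
`v(t,x) = b(t)` of the duality-form ancient class (4055), has INFINITE planar energy unless `b ≡ 0`,
so it satisfies the Liouville stub's conclusion or misses its hypothesis.)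

THE CRUX (Clay (A)-form, per datum). For every `ν > 0` and every smooth, divergence-free, rapidly
decaying datum `u₀` on `ℝ³`: IF every classical solution `(u,p)` of unforced NS on `ℝ³ × [0,T)` that is
Leray–Hopf from `u 0 = u₀` has planar kinetic energies `∫_{R({x₂=c})} |u(t)|² dA` bounded uniformly
in `t < T`, `R`, `c` (every `T > 0`), THEN Clay (A) holds for `u₀`.

THE CUT — exactly the route header's own two-layer plan ("BoundedPlanarEnergyRegularity ⇐
PlanarEnergyLiouville → PlanarEnergyZoomA", "PlanarEnergyZoomA ⇐ PlanarEnergyZoom (extension-form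
zoom) + LocalClayTheoryA"), flattened into three named stubs so that the per-datum local Clay theory —
"the one place where that price is paid" — is its own registered stub instead of hiding inside ZoomA:

* `stub_localClayTheory` [M; PROVABLE NOW — the per-datum form of the shared frame `NoBlowupToClay`
  (stmt-0055), proved in tree as `Theorems.typeICertificateLadder_noBlowupToClay_proof`, whose script
  invokes its `NoBlowup` hypothesis exactly once, at the grafted field `V` with `V 0 = u₀` — so the same
  script proves this stub; the only cost is that those proof modules are cone-dirty (26–31 unproved
  named facts in their import closure, none used), cf. the route header's CONE HYGIENE paragraph]:
  for a Clay datum `u₀`, if EVERY classical solution on `[0,T)` that is Leray–Hopf from `u 0 = u₀`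
  extends smoothly past `T` (every `T > 0`), then Clay (A) holds for `u₀` (Kato maximal-time
  dichotomy: global Kato solution ⇒ Clay solution; finite maximal time ⇒ a singular point
  (Lemarié-Rieusset Thm 15.1 (C)) of the classical Leray–Hopf representative grafted with Leray's weak
  solution, which the hypothesis continues smoothly — contradiction).
* `stub_planarEnergyZoom` [L; = support item `PlanarEnergyZoom` (stmt-NavierStokesRegularity-16858)
  VERBATIM — KNSS velocity-record zoom at bounded planar energy, extension form]: no smooth extension
  past `T` + planar energies `≤ M` on `[0,T)` ⇒ a bounded ancient mild solution `v` (`ν = 1`),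
  measurable slices, jointly smooth on `(−∞,0) × ℝ³`, planar energies `≤ M'` on every plane and slice,
  `v ≢ 0` (bounded velocity ⇒ extension, so records diverge; KNSS 2009 Prop 6.1 zoom at near-record
  points, in tree as `KNSS2009_blowup_generates_ancient` / `IsKNSSBlowupLimit`; `ν ↦ 1` by
  `u ↦ ν⁻¹u(x,t/ν)`; exact scale invariance of planar energy + Fatou plane by plane).
* `stub_planarEnergyLiouville` [OPEN — the load-bearing stub; = crux `PlanarEnergyLiouville`
  (stmt-NavierStokesRegularity-16856) VERBATIM]: a bounded ancient mild solution (`ν = 1`), measurable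
  slices, jointly smooth, with uniformly bounded planar energies, vanishes identically (weaker than
  KNSS (L): constants / parasitic drifts excluded by the hypothesis; steady corner proved —
  `SteadyPlanarLiouville` = Tsai 2021 / CJL 2019 via `ScaledEnergyOfPlanar`).

`BoundedPlanarEnergyRegularity_of_stubs : <sig localClay> → <sig zoom> → <sig liouville> → <crux
statement verbatim>` is the REAL composition (closed; pure logic, axioms `propext` /
`Classical.choice` / `Quot.sound`): fix `ν`, a Clay datum `u₀` and the planar hypothesis; feed
`stub_localClayTheory`, so it remains to continue an arbitrary classical Leray–Hopf `(u,p)` from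
`u 0 = u₀` past an arbitrary `T`; if it did not extend, the planar hypothesis gives `M` on `[0,T)` for
THIS `(u,p,T)`, the zoom stub gives a non-zero ancient `v` with bounded planar energies, and the
Liouville stub makes `v ≡ 0` — contradiction. `BoundedPlanarEnergyRegularity_of :
Theses.PlaneEnergyCeiling.BoundedPlanarEnergyRegularity` is the crux BY NAME (the unique theorem of
this file concluding the crux decl; no `Prop` hypotheses; placeholders only inside the three `stub_*`,
which it uses by name through `_of_stubs`).

Refuter note honoured (REVIEW-PlaneEnergyCeiling.md §4, item notes 2026-08-16T21:53): "hypothesis gives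
M per T — the user must instantiate T = T* with a field that is Leray–Hopf on [0,T*]": here the planar
hypothesis is instantiated at the very `(T,u,p)` handed over by `stub_localClayTheory`'s continuation
clause, and the in-tree proof pattern of that stub supplies exactly such a field at `T = T_max` (the
classical representative grafted with Leray's weak solution, `IsLerayHopfOn T_max`).

BC3 PROBES (registrar folder `bc/probe_*.lean`, `lean check`): for each stub `S`,
`S → BoundedPlanarEnergyRegularity` and `S → NavierStokesRegularity` by
`first | exact? | simpa | aesop` (plus `unfold`-variants) FAIL — results quoted in `Lines/birth.md` /
NOTES.md: no stub is cheaply the crux or the summit (stub 1 lacks the planar ⇒ extension criterion,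
stub 2 produces an ancient solution nobody kills, stub 3 never sees a Cauchy problem).
-/

noncomputable section

open Set MeasureTheory Filter Topology

namespace Summit.NavierStokesRegularity.NavierStokesRegularity.Cruxes.BoundedPlanarEnergyRegularity.Birth

set_option linter.unusedVariables false
set_option linter.dupNamespace false

/-- **stub 1 — `stub_localClayTheory` (M; provable now: per-datum `NoBlowupToClay`, pattern
`Theorems.typeICertificateLadder_noBlowupToClay_proof`).** For `ν > 0` and a smooth, divergence-free,
rapidly decaying datum `u₀`: if every classical solution `(u,p)` of unforced NS on `ℝ³ × [0,T)` that is
Leray–Hopf from `u 0 = u₀` extends smoothly past `T` (all `T > 0`), then Clay (A) holds for `u₀`. -/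
theorem stub_localClayTheory :
    ∀ (ν : ℝ), 0 < ν → ∀ (u₀ : EuclideanSpace ℝ (Fin 3) → EuclideanSpace ℝ (Fin 3)),
      ContDiff ℝ (⊤ : ℕ∞) u₀ → Literature.Analysis.FluidPDE.NSWave0.IsDivFree u₀ →
      Literature.Analysis.FluidPDE.HasRapidSpatialDecay u₀ →
      (∀ (T : ℝ), 0 < T →
        ∀ (u : ℝ → EuclideanSpace ℝ (Fin 3) → EuclideanSpace ℝ (Fin 3))
          (p : ℝ → EuclideanSpace ℝ (Fin 3) → ℝ),
          Literature.Analysis.FluidPDE.IsClassicalNSSolutionOn (Set.Ico 0 T) ν 0 u p →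
          Literature.Analysis.FluidPDE.IsLerayHopfOn T ν 0 (u 0) u → u 0 = u₀ →
          Literature.Analysis.FluidPDE.HasSmoothExtensionPast ν 0 u T) →
      ∃ (u : ℝ → EuclideanSpace ℝ (Fin 3) → EuclideanSpace ℝ (Fin 3))
        (p : ℝ → EuclideanSpace ℝ (Fin 3) → ℝ),
        Literature.Analysis.FluidPDE.IsSmoothOnHalfSpace u ∧
        Literature.Analysis.FluidPDE.IsSmoothOnHalfSpace p ∧
        Literature.Analysis.FluidPDE.IsNavierStokesSolution ν 0 u₀ u p ∧
        Literature.Analysis.FluidPDE.HasBoundedEnergy u := by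
  sorry

/-- **stub 2 — `stub_planarEnergyZoom` (L; = support item `PlanarEnergyZoom`,
stmt-NavierStokesRegularity-16858, verbatim).** Velocity-record zoom at bounded planar energy,
extension form: a classical Leray–Hopf solution from a rapidly decaying datum with no smooth extension
past `T` and planar energies `≤ M` on `[0,T)` yields a bounded ancient mild solution `v` (`ν = 1`),
measurable slices, jointly smooth on `(−∞,0) × ℝ³`, planar energies `≤ M'`, and `v ≢ 0`. -/
theorem stub_planarEnergyZoom :
    ∀ (ν T : ℝ), 0 < ν → 0 < T →
      ∀ (u : ℝ → EuclideanSpace ℝ (Fin 3) → EuclideanSpace ℝ (Fin 3))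
        (p : ℝ → EuclideanSpace ℝ (Fin 3) → ℝ),
        Literature.Analysis.FluidPDE.IsClassicalNSSolutionOn (Set.Ico 0 T) ν 0 u p →
        Literature.Analysis.FluidPDE.IsLerayHopfOn T ν 0 (u 0) u →
        Literature.Analysis.FluidPDE.HasRapidSpatialDecay (u 0) →
        ¬ Literature.Analysis.FluidPDE.HasSmoothExtensionPast ν 0 u T →
        (∃ M : ℝ, ∀ t ∈ Set.Ico 0 T,
          ∀ (R : EuclideanSpace ℝ (Fin 3) ≃ₗᵢ[ℝ] EuclideanSpace ℝ (Fin 3)) (c : ℝ),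
            ∫⁻ y : EuclideanSpace ℝ (Fin 2), ‖u t (R (WithLp.toLp 2 ![y 0, y 1, c]))‖ₑ ^ 2
              ≤ ENNReal.ofReal M) →
        ∃ (v : ℝ → EuclideanSpace ℝ (Fin 3) → EuclideanSpace ℝ (Fin 3)) (M' : ℝ),
          Literature.Analysis.FluidPDE.IsBoundedAncientMildSolution 1 v ∧
          (∀ t < 0, MeasureTheory.AEStronglyMeasurable (v t) MeasureTheory.volume) ∧
          ContDiffOn ℝ (⊤ : ℕ∞) (Function.uncurry v) (Set.Iio 0 ×ˢ Set.univ) ∧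
          (∀ t < 0, ∀ (R : EuclideanSpace ℝ (Fin 3) ≃ₗᵢ[ℝ] EuclideanSpace ℝ (Fin 3)) (c : ℝ),
            ∫⁻ y : EuclideanSpace ℝ (Fin 2), ‖v t (R (WithLp.toLp 2 ![y 0, y 1, c]))‖ₑ ^ 2
              ≤ ENNReal.ofReal M') ∧
          ∃ t < 0, ∃ x, v t x ≠ 0 := by
  sorry

/-- **stub 3 — `stub_planarEnergyLiouville` (OPEN — the load-bearing stub; = crux
`PlanarEnergyLiouville`, stmt-NavierStokesRegularity-16856, verbatim).** A bounded ancient mild solution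
of NS (`ν = 1`, KNSS duality-form class), measurable slices, jointly smooth on `(−∞,0) × ℝ³`, whose
planar kinetic energies are bounded uniformly in `t`, `R`, `c`, is identically zero. -/
theorem stub_planarEnergyLiouville :
    ∀ (v : ℝ → EuclideanSpace ℝ (Fin 3) → EuclideanSpace ℝ (Fin 3)),
      Literature.Analysis.FluidPDE.IsBoundedAncientMildSolution 1 v →
      (∀ t < 0, MeasureTheory.AEStronglyMeasurable (v t) MeasureTheory.volume) →
      ContDiffOn ℝ (⊤ : ℕ∞) (Function.uncurry v) (Set.Iio 0 ×ˢ Set.univ) →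
      (∃ M : ℝ, ∀ t < 0, ∀ (R : EuclideanSpace ℝ (Fin 3) ≃ₗᵢ[ℝ] EuclideanSpace ℝ (Fin 3)) (c : ℝ),
        ∫⁻ y : EuclideanSpace ℝ (Fin 2), ‖v t (R (WithLp.toLp 2 ![y 0, y 1, c]))‖ₑ ^ 2
          ≤ ENNReal.ofReal M) →
      ∀ t < 0, ∀ x, v t x = 0 := by
  sorry

/-- **Birth composition, hypothesis form (closed; pure logic).** The three stub STATEMENTS, taken as
hypotheses, imply the crux STATEMENT (spelled out verbatim from
`Theses.PlaneEnergyCeiling.BoundedPlanarEnergyRegularity`; the by-name form is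
`BoundedPlanarEnergyRegularity_of` below). Feed the local Clay theory; to continue an arbitrary
classical Leray–Hopf `(u,p)` from `u 0 = u₀` past `T`, argue by contradiction: the planar hypothesis
bounds the planar energies of THIS solution on `[0,T)`, the zoom produces a non-zero bounded ancient
mild solution with bounded planar energies, and the Liouville stub kills it. -/
theorem BoundedPlanarEnergyRegularity_of_stubs :
    (∀ (ν : ℝ), 0 < ν → ∀ (u₀ : EuclideanSpace ℝ (Fin 3) → EuclideanSpace ℝ (Fin 3)),
      ContDiff ℝ (⊤ : ℕ∞) u₀ → Literature.Analysis.FluidPDE.NSWave0.IsDivFree u₀ →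
      Literature.Analysis.FluidPDE.HasRapidSpatialDecay u₀ →
      (∀ (T : ℝ), 0 < T →
        ∀ (u : ℝ → EuclideanSpace ℝ (Fin 3) → EuclideanSpace ℝ (Fin 3))
          (p : ℝ → EuclideanSpace ℝ (Fin 3) → ℝ),
          Literature.Analysis.FluidPDE.IsClassicalNSSolutionOn (Set.Ico 0 T) ν 0 u p →
          Literature.Analysis.FluidPDE.IsLerayHopfOn T ν 0 (u 0) u → u 0 = u₀ →
          Literature.Analysis.FluidPDE.HasSmoothExtensionPast ν 0 u T) →
      ∃ (u : ℝ → EuclideanSpace ℝ (Fin 3) → EuclideanSpace ℝ (Fin 3))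
        (p : ℝ → EuclideanSpace ℝ (Fin 3) → ℝ),
        Literature.Analysis.FluidPDE.IsSmoothOnHalfSpace u ∧
        Literature.Analysis.FluidPDE.IsSmoothOnHalfSpace p ∧
        Literature.Analysis.FluidPDE.IsNavierStokesSolution ν 0 u₀ u p ∧
        Literature.Analysis.FluidPDE.HasBoundedEnergy u) →
    (∀ (ν T : ℝ), 0 < ν → 0 < T →
      ∀ (u : ℝ → EuclideanSpace ℝ (Fin 3) → EuclideanSpace ℝ (Fin 3))
        (p : ℝ → EuclideanSpace ℝ (Fin 3) → ℝ),
        Literature.Analysis.FluidPDE.IsClassicalNSSolutionOn (Set.Ico 0 T) ν 0 u p →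
        Literature.Analysis.FluidPDE.IsLerayHopfOn T ν 0 (u 0) u →
        Literature.Analysis.FluidPDE.HasRapidSpatialDecay (u 0) →
        ¬ Literature.Analysis.FluidPDE.HasSmoothExtensionPast ν 0 u T →
        (∃ M : ℝ, ∀ t ∈ Set.Ico 0 T,
          ∀ (R : EuclideanSpace ℝ (Fin 3) ≃ₗᵢ[ℝ] EuclideanSpace ℝ (Fin 3)) (c : ℝ),
            ∫⁻ y : EuclideanSpace ℝ (Fin 2), ‖u t (R (WithLp.toLp 2 ![y 0, y 1, c]))‖ₑ ^ 2
              ≤ ENNReal.ofReal M) →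
        ∃ (v : ℝ → EuclideanSpace ℝ (Fin 3) → EuclideanSpace ℝ (Fin 3)) (M' : ℝ),
          Literature.Analysis.FluidPDE.IsBoundedAncientMildSolution 1 v ∧
          (∀ t < 0, MeasureTheory.AEStronglyMeasurable (v t) MeasureTheory.volume) ∧
          ContDiffOn ℝ (⊤ : ℕ∞) (Function.uncurry v) (Set.Iio 0 ×ˢ Set.univ) ∧
          (∀ t < 0, ∀ (R : EuclideanSpace ℝ (Fin 3) ≃ₗᵢ[ℝ] EuclideanSpace ℝ (Fin 3)) (c : ℝ),
            ∫⁻ y : EuclideanSpace ℝ (Fin 2), ‖v t (R (WithLp.toLp 2 ![y 0, y 1, c]))‖ₑ ^ 2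
              ≤ ENNReal.ofReal M') ∧
          ∃ t < 0, ∃ x, v t x ≠ 0) →
    (∀ (v : ℝ → EuclideanSpace ℝ (Fin 3) → EuclideanSpace ℝ (Fin 3)),
      Literature.Analysis.FluidPDE.IsBoundedAncientMildSolution 1 v →
      (∀ t < 0, MeasureTheory.AEStronglyMeasurable (v t) MeasureTheory.volume) →
      ContDiffOn ℝ (⊤ : ℕ∞) (Function.uncurry v) (Set.Iio 0 ×ˢ Set.univ) →
      (∃ M : ℝ, ∀ t < 0, ∀ (R : EuclideanSpace ℝ (Fin 3) ≃ₗᵢ[ℝ] EuclideanSpace ℝ (Fin 3)) (c : ℝ),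
        ∫⁻ y : EuclideanSpace ℝ (Fin 2), ‖v t (R (WithLp.toLp 2 ![y 0, y 1, c]))‖ₑ ^ 2
          ≤ ENNReal.ofReal M) →
      ∀ t < 0, ∀ x, v t x = 0) →
    -- the crux statement, verbatim (cf. `Theses.PlaneEnergyCeiling.BoundedPlanarEnergyRegularity`):
    ∀ (ν : ℝ), 0 < ν → ∀ (u₀ : EuclideanSpace ℝ (Fin 3) → EuclideanSpace ℝ (Fin 3)),
      ContDiff ℝ (⊤ : ℕ∞) u₀ → Literature.Analysis.FluidPDE.NSWave0.IsDivFree u₀ →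
      Literature.Analysis.FluidPDE.HasRapidSpatialDecay u₀ →
      (∀ (T : ℝ), 0 < T →
        ∀ (u : ℝ → EuclideanSpace ℝ (Fin 3) → EuclideanSpace ℝ (Fin 3))
          (p : ℝ → EuclideanSpace ℝ (Fin 3) → ℝ),
          Literature.Analysis.FluidPDE.IsClassicalNSSolutionOn (Set.Ico 0 T) ν 0 u p →
          Literature.Analysis.FluidPDE.IsLerayHopfOn T ν 0 (u 0) u → u 0 = u₀ →
          ∃ M : ℝ, ∀ t ∈ Set.Ico 0 T,
            ∀ (R : EuclideanSpace ℝ (Fin 3) ≃ₗᵢ[ℝ] EuclideanSpace ℝ (Fin 3)) (c : ℝ),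
              ∫⁻ y : EuclideanSpace ℝ (Fin 2), ‖u t (R (WithLp.toLp 2 ![y 0, y 1, c]))‖ₑ ^ 2
                ≤ ENNReal.ofReal M) →
      ∃ (u : ℝ → EuclideanSpace ℝ (Fin 3) → EuclideanSpace ℝ (Fin 3))
        (p : ℝ → EuclideanSpace ℝ (Fin 3) → ℝ),
        Literature.Analysis.FluidPDE.IsSmoothOnHalfSpace u ∧
        Literature.Analysis.FluidPDE.IsSmoothOnHalfSpace p ∧
        Literature.Analysis.FluidPDE.IsNavierStokesSolution ν 0 u₀ u p ∧
        Literature.Analysis.FluidPDE.HasBoundedEnergy u := by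
  intro hClay hZoom hLiouville ν hν u₀ hu₀ hdiv hdec hplanar
  -- Step 1 (local Clay theory): it suffices to continue every classical Leray–Hopf `(u,p)` from `u₀`.
  refine hClay ν hν u₀ hu₀ hdiv hdec ?_
  intro T hT u p hcl hLH h0
  -- Step 2: if `(u,p)` did not extend past `T` …
  by_contra hne
  -- … the planar hypothesis bounds the planar energies of THIS solution on `[0,T)` …
  obtain ⟨M, hM⟩ := hplanar T hT u p hcl hLH h0
  have hdec0 : Literature.Analysis.FluidPDE.HasRapidSpatialDecay (u 0) := by
    rw [h0]
    exact hdec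
  -- … the velocity-record zoom yields a non-zero bounded ancient mild solution with bounded planar
  -- energies …
  obtain ⟨v, M', hv, hmeas, hsm, hpl, t, ht, x, hx⟩ :=
    hZoom ν T hν hT u p hcl hLH hdec0 hne ⟨M, hM⟩
  -- … which the planar-energy Liouville theorem kills.
  exact hx (hLiouville v hv hmeas hsm ⟨M', hpl⟩ t ht x)

/-- **The skeleton, by name** (the unique theorem of this file concluding the crux decl):
`BoundedPlanarEnergyRegularity` BY NAME, as the closed composition
`BoundedPlanarEnergyRegularity_of_stubs` applied to exactly the three registered stubs (it inherits
their placeholders and nothing else; the crux def unfolds to the composition's conclusion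
definitionally). -/
theorem BoundedPlanarEnergyRegularity_of :
    Summit.NavierStokesRegularity.NavierStokesRegularity.Theses.PlaneEnergyCeiling.BoundedPlanarEnergyRegularity :=
  BoundedPlanarEnergyRegularity_of_stubs stub_localClayTheory stub_planarEnergyZoom
    stub_planarEnergyLiouville

end Summit.NavierStokesRegularity.NavierStokesRegularity.Cruxes.BoundedPlanarEnergyRegularity.Birth

end
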